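import Summits.QuantumFields.YangMills.Theorems.HyperbolicRegulatorCurvatureUniformityRChartDefs

/-!
# Route `HyperbolicRegulator`, crux `CurvatureUniformityR` (stmt-QuantumFields-18154): destructuring the repaired admissibility

Helper file of the line `single-chart-markov` (lead `prover-line-stmt-QuantumFields-18154-0`): the nine axioms of
`SingleChartMarkov.AdmR` (= the crux's `(Fam k j …).1`, `Theorems/HyperbolicRegulatorCurvatureUniformityRChartDefs.lean`) as
one-line projections in the named vocabulary (`degOf`, `conesOf`, `graphOf`, `IsFlatR`, `inBox2`, `nx2`) — definitional
unfolding only (A1 = `hA.1` and A3 = `hA.2.2.1` are used directly; identical projections exist for the sibling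
`CurvatureAnchorR.WittenHessian.AdmR` in `HyperbolicRegulatorCurvatureAnchorRDefs.lean`), shared by the stub files of the skeleton `Cruxes/CurvatureUniformityR/Lines/Sketch.lean`. Nothing is asserted
about the route.
-/

set_option autoImplicit false

namespace Summit.QuantumFields.YangMills.Cruxes.CurvatureUniformityR.SingleChartMarkov

open Summit.QuantumFields.YangMills.Cruxes.HyperbolicToTorus.NoAdmissibleComplex (graphOf degOf conesOf)

variable {k j : ℕ} {V E Q : Finset ℕ} {σ τ : ℕ → ℕ} {bd : ℕ → Fin 4 → ℕ × Bool} {cV : ℕ → ℤ × ℤ → ℕ}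
  {cE : ℕ → ℤ × ℤ → Fin 2 → ℕ × Bool}

/-- A2: square boundaries — edges in `E`, consecutive (`en (bd q i) = st (bd q (i+1))`), injective corners. -/
theorem AdmR.squares (hA : AdmR k j V E Q σ τ bd cV cE) :
    ∀ q ∈ Q, (∀ i, (bd q i).1 ∈ E) ∧
      (∀ i, (fun e : ℕ × Bool => if e.2 then τ e.1 else σ e.1) (bd q i) =
        (fun e : ℕ × Bool => if e.2 then σ e.1 else τ e.1) (bd q (i + 1))) ∧
      Function.Injective ((fun e : ℕ × Bool => if e.2 then σ e.1 else τ e.1) ∘ bd q) := hA.2.1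

/-- A4: vertex degrees are 4 or 5 and the number of squares at a vertex equals its degree. -/
theorem AdmR.degree (hA : AdmR k j V E Q σ τ bd cV cE) :
    ∀ x ∈ V, (degOf E σ τ x = 4 ∨ degOf E σ τ x = 5) ∧
      (Q.filter fun q => ∃ i, (fun e : ℕ × Bool => if e.2 then σ e.1 else τ e.1) (bd q i) = x).card = degOf E σ τ x :=
  hA.2.2.2.1

/-- A5: cones are `k`-dense. -/
theorem AdmR.dense (hA : AdmR k j V E Q σ τ bd cV cE) :
    ∀ x ∈ V, ∃ c ∈ conesOf V E σ τ, (graphOf E σ τ).dist x c ≤ k := hA.2.2.2.2.1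

/-- A6: cones are `k`-separated. -/
theorem AdmR.separated (hA : AdmR k j V E Q σ τ bd cV cE) :
    ∀ c ∈ conesOf V E σ τ, ∀ c' ∈ conesOf V E σ τ, c ≠ c' → k ≤ (graphOf E σ τ).dist c c' := hA.2.2.2.2.2.1

/-- A7: the Poincaré inequality with constant `10⁶ k²`. -/
theorem AdmR.poincare (hA : AdmR k j V E Q σ τ bd cV cE) :
    ∀ f : ℕ → ℝ, ∑ x ∈ V, f x = 0 → ∑ x ∈ V, f x ^ 2 ≤ 10 ^ 6 * (k : ℝ) ^ 2 * ∑ e ∈ E, (f (σ e) - f (τ e)) ^ 2 :=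
  hA.2.2.2.2.2.2.1

/-- A8: two deep points at distance `≥ j`. -/
theorem AdmR.deep (hA : AdmR k j V E Q σ τ bd cV cE) :
    ∃ x y, (x ∈ V ∧ ∀ c ∈ conesOf V E σ τ, 3 * (k / 4) < (graphOf E σ τ).dist x c) ∧
      (y ∈ V ∧ ∀ c ∈ conesOf V E σ τ, 3 * (k / 4) < (graphOf E σ τ).dist y c) ∧ j ≤ (graphOf E σ τ).dist x y :=
  hA.2.2.2.2.2.2.2.1

/-- A9: the flat chart at a flat vertex `x` — centre, vertices in `V`, injectivity on the box, edges, unit squares. -/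
theorem AdmR.chart (hA : AdmR k j V E Q σ τ bd cV cE) {x : ℕ} (hx : IsFlatR k V E σ τ x) :
    cV x (0, 0) = x ∧ (∀ a, inBox2 k a → cV x a ∈ V) ∧ Set.InjOn (cV x) {a | inBox2 k a} ∧
      (∀ a μ, inBox2 k a → inBox2 k (nx2 a μ) → (cE x a μ).1 ∈ E ∧
        (fun e : ℕ × Bool => if e.2 then σ e.1 else τ e.1) (cE x a μ) = cV x a ∧
        (fun e : ℕ × Bool => if e.2 then τ e.1 else σ e.1) (cE x a μ) = cV x (nx2 a μ)) ∧
      (∀ a, inBox2 k a → inBox2 k (a.1 + 1, a.2 + 1) → ∃ q ∈ Q, Finset.univ.image (Prod.fst ∘ bd q) =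
        {(cE x a 0).1, (cE x (nx2 a 0) 1).1, (cE x (nx2 a 1) 0).1, (cE x a 1).1}) :=
  hA.2.2.2.2.2.2.2.2 x hx

/-- A9, one chart edge: membership in `E` and its flagged endpoints (`st = cV x a`, `en = cV x (nx2 a μ)`). -/
theorem AdmR.chart_edge (hA : AdmR k j V E Q σ τ bd cV cE) {x : ℕ} (hx : IsFlatR k V E σ τ x) (a : ℤ × ℤ) (μ : Fin 2)
    (ha : inBox2 k a) (hb : inBox2 k (nx2 a μ)) :
    (cE x a μ).1 ∈ E ∧ (if (cE x a μ).2 then σ (cE x a μ).1 else τ (cE x a μ).1) = cV x a ∧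
      (if (cE x a μ).2 then τ (cE x a μ).1 else σ (cE x a μ).1) = cV x (nx2 a μ) :=
  (hA.chart hx).2.2.2.1 a μ ha hb

/-- A flat vertex is a vertex. -/
theorem IsFlatR.mem {x : ℕ} (hx : IsFlatR k V E σ τ x) : x ∈ V := hx.1

end Summit.QuantumFields.YangMills.Cruxes.CurvatureUniformityR.SingleChartMarkov
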